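/-
Copyright: rh-split cell (screw, bridge) gen 14, 2026-08-27.  Splitting search over kernel-typed
RH-equivalences.  A splitting `A ∧ B ⟹ RH` is CONDITIONAL bookkeeping unless `A` and `B` are both
proved; nothing here bears on the truth of RH.
-/
import Summits.RiemannHypothesis.RiemannHypothesis.Theorems.Splittings.ScrewBorelContinuationC
import Summits.RiemannHypothesis.RiemannHypothesis.Theorems.Splittings.ScrewLatticeSupB2
import Summits.RiemannHypothesis.RiemannHypothesis.Theorems.Splittings.ScrewLatticePSD
import HarnessLib

/-!
# Row X-9 — `CEIL(h) ∧ CC(h) ⟺ RH`: analytic continuation of the lattice generating function of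
Suzuki's screw function through the ALIASED POLE FIELD

Fix a step `h > 0` and write `κ_ρ = ρ - 1/2`, `c_ρ = m(ρ)/κ_ρ²`, `u_ρ = e^{κ_ρ h}` over the non-trivial zeros
`ρ` of `ζ`.  By Suzuki 2023 Thm 1.1 (2) (`Suzuki2023_thm11_series_holds`), `Ψ(k h) = ∑_ρ c_ρ (cosh(κ_ρ k h) - 1)`,
so the LATTICE GENERATING FUNCTION `P_h(z) = ∑_k Ψ(k h) z^k` (`latticeGF`) equals, for `‖z‖ < e^{-h/2}`, the
Borel series `∑_ρ c_ρ((1/2)((1 - u_ρ z)⁻¹ + (1 - z/u_ρ)⁻¹) - (1 - z)⁻¹)` of `ScrewBorelContinuation`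
(`latticeGF_eq_borel`).  Its poles inside the unit disc — the ALIASED POLE FIELD `aliasedPoleSet h` — are
exactly the points `e^{∓κ_ρ h}` of norm `e^{-|Re ρ - 1/2| h} < 1`, i.e. they come from the OFF-LINE zeros
only; `RH ⟺ aliasedPoleSet h = ∅`.

* `CEIL(h)` (`LatticeCeiling h`): `∀ ε > 0, ∃ K, ∀ k, |Ψ(k h)| ≤ K e^{ε k}` — the lattice generating
  function has radius of convergence `≥ 1`.  RH-implied (`Ψ` is then bounded,
  `ZetaScrewGrowth.abs_zetaScrew_le_of_RH`); implied by lattice boundedness, and by `LPSD(h)` through the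
  quadratic ceiling `0 ≤ Ψ(k h) ≤ k² Ψ(h)` (`ScrewLatticePSD.zetaScrew_lattice_le_sq_mul`).
* `CC(h)` (`CountableClosure h`): the closure of the aliased pole field is COUNTABLE inside the disc.
  RH-implied (the field is empty); implied by `CofiniteCriticalLine` (the field is finite).

**Row X-9** (`latticeCeiling_and_countableClosure_iff_rh`): `CEIL(h) ∧ CC(h) ⟺ RH`, by the ζ-free
continuation theorem `ScrewBorel.norm_eq_one_of_countable_closure`.  RH-free content
(`latticeCeiling_dichotomy`): `CEIL(h) ⟹ RH ∨ ¬CC(h)` — if the lattice samples of `Ψ` grow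
sub-exponentially in `k` then either RH holds or the aliased pole field has UNCOUNTABLE closure in the
disc: Wolff-type walls of poles (barrier candidate B16 of the cell) are then NECESSARY, not only
sufficient, for lattice blindness.  Corollaries: `FOZ ∧ CEIL(h) ⟺ RH` (positivity-free companion of
row X-8), `LPSD(h) ∧ CC(h) ⟺ RH`, and (§6) `ES ∧ CEIL(h) ⟺ RH` with `ES` the EVENTUAL STRIP (finitely
many zeros beyond every strip `|Re ρ - 1/2| ≥ η > 0`; `ES ⟹ CC(h)`).  §7 is the countability-free
WALLS THEOREM (`not_mem_closure_of_isolated_of_latticeCeiling`): under `CEIL(h)` no aliased pole that is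
isolated in the closure of the pole field is adherent to a preconnected region `V ∋ 0` of the complement —
the pole field must separate the origin from each of its isolated points.

No `sorry`, no new axioms, no instances, no notation.
-/

set_option linter.dupNamespace false

namespace Summit.RiemannHypothesis.RiemannHypothesis.Theorems.Splittings.ScrewLatticeContinuation

open Complex Filter Topology Set Metric
open Literature.NumberTheory.LFunctions
open ZetaZeros.riemannZetaNontrivialZeros
open Summit.RiemannHypothesis.RiemannHypothesis.Theorems.Splittings
open Summit.RiemannHypothesis.RiemannHypothesis.Theorems.Splittings.ScrewBorel

/-! ## 1. The objects -/

/-- `CEIL(h)`: the lattice samples `Ψ(k h)` grow sub-exponentially in `k`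
(the lattice generating function has radius of convergence `≥ 1`).  Open; RH-implied
(`latticeCeiling_of_rh`). -/
@[conjecture] def LatticeCeiling (h : ℝ) : Prop :=
  ∀ ε : ℝ, 0 < ε → ∃ K : ℝ, ∀ k : ℕ, |zetaScrew (k * h)| ≤ K * Real.exp (ε * k)

/-- The coefficient `c_ρ = m(ρ)/(ρ - 1/2)²` of the zero `ρ` in Suzuki's series. -/
noncomputable def coeff (ρ : ZetaZeros.riemannZetaNontrivialZeros) : ℂ :=
  (riemannZetaZeroOrder (ρ : ℂ) : ℂ) / ((ρ : ℂ) - 1 / 2) ^ 2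

/-- The lattice multiplier `u_ρ = e^{(ρ - 1/2) h}` of the zero `ρ`. -/
noncomputable def mult (h : ℝ) (ρ : ZetaZeros.riemannZetaNontrivialZeros) : ℂ :=
  Complex.exp (((ρ : ℂ) - 1 / 2) * h)

/-- The ALIASED POLE FIELD of step `h`: the points `e^{±(ρ - 1/2) h}` of norm `< 1`. -/
def aliasedPoleSet (h : ℝ) : Set ℂ := poleSet (mult h)

/-- `CC(h)`: the closure of the aliased pole field is countable inside the unit disc.  Open; RH-implied
(`countableClosure_of_rh`: under RH the field is empty). -/
@[conjecture] def CountableClosure (h : ℝ) : Prop := (closure (aliasedPoleSet h) ∩ ball 0 1).Countable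

/-- The lattice generating function `P_h(z) = ∑_k Ψ(k h) z^k`. -/
noncomputable def latticeGF (h : ℝ) (z : ℂ) : ℂ := ∑' k : ℕ, (zetaScrew (k * h) : ℂ) * z ^ k

/-- Unfolded membership in the aliased pole field. -/
theorem mem_aliasedPoleSet_iff {h : ℝ} {p : ℂ} :
    p ∈ aliasedPoleSet h ↔ ‖p‖ < 1 ∧ ∃ ρ : ZetaZeros.riemannZetaNontrivialZeros,
      p = Complex.exp (((ρ : ℂ) - 1 / 2) * h) ∨ p = (Complex.exp (((ρ : ℂ) - 1 / 2) * h))⁻¹ :=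
  Iff.rfl

/-- `‖u_ρ‖ = e^{(Re ρ - 1/2) h}`. -/
theorem norm_mult (h : ℝ) (ρ : ZetaZeros.riemannZetaNontrivialZeros) :
    ‖mult h ρ‖ = Real.exp (((ρ : ℂ).re - 1 / 2) * h) := by
  unfold mult
  rw [Complex.norm_exp]
  congr 1
  simp [Complex.mul_re, Complex.sub_re]

/-- `u_ρ ≠ 0`. -/
theorem mult_ne_zero (h : ℝ) (ρ : ZetaZeros.riemannZetaNontrivialZeros) : mult h ρ ≠ 0 :=
  Complex.exp_ne_zero _

/-- `∑_ρ ‖c_ρ‖ < ∞` (`‖c_ρ‖ ≤ 2 m(ρ)/γ²`, `ScrewLatticeSup.norm_coeff_le`). -/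
theorem summable_norm_coeff : Summable fun ρ : ZetaZeros.riemannZetaNontrivialZeros ↦ ‖coeff ρ‖ :=
  Summable.of_nonneg_of_le (fun _ ↦ norm_nonneg _) (fun ρ ↦ ScrewLatticeSup.norm_coeff_le ρ)
    ZetaScrewGrowth.summable_two_mul_order_div_im_sq

/-- `Re c_ρ < 0` (`ScrewLatticeFoz.re_coeff_neg`). -/
theorem re_coeff_neg (ρ : ZetaZeros.riemannZetaNontrivialZeros) : (coeff ρ).re < 0 :=
  ScrewLatticeFoz.re_coeff_neg ρ

/-- Every aliased pole has norm `≥ e^{-h/2}` (`|Re ρ - 1/2| < 1/2`), for `h ≥ 0`. -/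
theorem exp_neg_half_le_norm_of_mem {h : ℝ} (hh : 0 ≤ h) {p : ℂ} (hp : p ∈ aliasedPoleSet h) :
    Real.exp (-(h / 2)) ≤ ‖p‖ := by
  obtain ⟨-, ρ, hp | hp⟩ := hp
  · have hp' : p = mult h ρ := hp
    rw [hp', norm_mult]
    refine Real.exp_le_exp.2 ?_
    have h0 := re_pos ρ.2
    nlinarith
  · have hp' : p = (mult h ρ)⁻¹ := hp
    rw [hp', norm_inv, norm_mult, ← Real.exp_neg]
    refine Real.exp_le_exp.2 ?_
    have h1 := re_lt_one ρ.2
    nlinarith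

/-! ## 2. `CEIL(h)` makes the lattice generating function holomorphic on the unit disc -/

/-- Under `CEIL(h)` the lattice generating function is complex-differentiable on `ball 0 1`. -/
theorem differentiableOn_latticeGF {h : ℝ} (hceil : LatticeCeiling h) :
    DifferentiableOn ℂ (latticeGF h) (ball 0 1) := by
  intro z₀ hz₀
  rw [mem_ball_zero_iff] at hz₀
  set r : ℝ := (‖z₀‖ + 1) / 2 with hr
  have hr0 : 0 < r := by rw [hr]; linarith [norm_nonneg z₀]
  have hr1 : r < 1 := by rw [hr]; linarith
  have hz₀r : ‖z₀‖ < r := by rw [hr]; linarith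
  set ε : ℝ := (1 - r) / 2 with hε
  have hε0 : 0 < ε := by rw [hε]; linarith
  obtain ⟨K, hK⟩ := hceil ε hε0
  set q : ℝ := Real.exp ε * r with hq
  have hq0 : 0 ≤ q := by positivity
  have hq1 : q < 1 := by
    have hlog : Real.log r ≤ r - 1 := Real.log_le_sub_one_of_pos hr0
    calc q = Real.exp ε * Real.exp (Real.log r) := by rw [hq, Real.exp_log hr0]
      _ = Real.exp (ε + Real.log r) := (Real.exp_add _ _).symm
      _ < 1 := Real.exp_lt_one_iff.2 (by rw [hε]; linarith)
  have hK0 : 0 ≤ K := by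
    have := hK 0
    norm_num at this
    exact (abs_nonneg _).trans this
  have hdiff : DifferentiableOn ℂ (latticeGF h) (ball 0 r) := by
    refine differentiableOn_tsum_of_summable_norm (u := fun k : ℕ ↦ K * q ^ k)
      ((summable_geometric_of_lt_one hq0 hq1).mul_left K) (fun k ↦ ?_) isOpen_ball (fun k z hz ↦ ?_)
    · exact ((differentiableOn_const _).mul (differentiableOn_id.pow k))
    · rw [mem_ball_zero_iff] at hz
      rw [norm_mul, norm_pow, Complex.norm_real, Real.norm_eq_abs]
      have h1 := hK k
      have h2 : ‖z‖ ^ k ≤ r ^ k := pow_le_pow_left₀ (norm_nonneg _) hz.le k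
      have h3 : Real.exp (ε * k) * r ^ k = q ^ k := by
        rw [hq, mul_pow, mul_comm ε, Real.exp_nat_mul]
      calc |zetaScrew (k * h)| * ‖z‖ ^ k ≤ (K * Real.exp (ε * k)) * r ^ k := by gcongr
        _ = K * q ^ k := by rw [mul_assoc, h3]
  exact (hdiff.differentiableAt (isOpen_ball.mem_nhds (mem_ball_zero_iff.2 hz₀r))).differentiableWithinAt

/-! ## 3. The lattice generating function IS the Borel series near `0` (Suzuki Thm 1.1 (2) + Fubini) -/

/-- `cosh` on the lattice: `cosh((ρ - 1/2) k h) = (u_ρ^k + (u_ρ^k)⁻¹)/2`. -/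
theorem cosh_lattice (h : ℝ) (ρ : ZetaZeros.riemannZetaNontrivialZeros) (k : ℕ) :
    Complex.cosh (((ρ : ℂ) - 1 / 2) * (((k : ℝ) * h : ℝ) : ℂ)) =
      ((mult h ρ) ^ k + ((mult h ρ) ^ k)⁻¹) / 2 := by
  have e1 : ((ρ : ℂ) - 1 / 2) * (((k : ℝ) * h : ℝ) : ℂ) = (k : ℂ) * (((ρ : ℂ) - 1 / 2) * (h : ℂ)) := by
    push_cast; ring
  have e2 : Complex.cosh ((k : ℂ) * (((ρ : ℂ) - 1 / 2) * (h : ℂ))) =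
      (Complex.exp ((k : ℂ) * (((ρ : ℂ) - 1 / 2) * (h : ℂ))) +
        Complex.exp (-((k : ℂ) * (((ρ : ℂ) - 1 / 2) * (h : ℂ))))) / 2 := by
    rw [← Complex.two_cosh]; ring
  rw [e1, e2, Complex.exp_neg, Complex.exp_nat_mul]
  rfl

/-- **One zero.**  For `‖u_ρ z‖ < 1`, `‖z/u_ρ‖ < 1`, `‖z‖ < 1` the `ρ`-th row of the double series sums over
`k` to the Borel term: `∑_k c_ρ (cosh(κ_ρ k h) - 1) z^k = term c_ρ u_ρ z` (three geometric series). -/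
theorem hasSum_row (h : ℝ) (ρ : ZetaZeros.riemannZetaNontrivialZeros) {z : ℂ}
    (h1 : ‖mult h ρ * z‖ < 1) (h2 : ‖z / mult h ρ‖ < 1) (h3 : ‖z‖ < 1) :
    HasSum (fun k : ℕ ↦ (riemannZetaZeroOrder (ρ : ℂ) : ℂ) *
        ((Complex.cosh (((ρ : ℂ) - 1 / 2) * (((k : ℝ) * h : ℝ) : ℂ)) - 1) / ((ρ : ℂ) - 1 / 2) ^ 2) *
          z ^ k) (term (coeff ρ) (mult h ρ) z) := by
  have hu : mult h ρ ≠ 0 := mult_ne_zero h ρ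
  have g1 := hasSum_geometric_of_norm_lt_one h1
  have g2 := hasSum_geometric_of_norm_lt_one h2
  have g3 := hasSum_geometric_of_norm_lt_one h3
  have G := (((g1.add g2).mul_left (1 / 2 : ℂ)).sub g3).mul_left (coeff ρ)
  have e : (fun k : ℕ ↦ (riemannZetaZeroOrder (ρ : ℂ) : ℂ) *
        ((Complex.cosh (((ρ : ℂ) - 1 / 2) * (((k : ℝ) * h : ℝ) : ℂ)) - 1) / ((ρ : ℂ) - 1 / 2) ^ 2) *
          z ^ k) =
      fun k : ℕ ↦ coeff ρ * ((1 / 2 : ℂ) * ((mult h ρ * z) ^ k + (z / mult h ρ) ^ k) - z ^ k) := by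
    funext k
    rw [cosh_lattice, mul_pow, div_pow, div_eq_mul_inv (z ^ k) (mult h ρ ^ k)]
    unfold coeff
    ring
  rw [e]
  exact G

/-- **Near `0` the lattice generating function equals the Borel series** (`h > 0`, `‖z‖ < e^{-h/2}`):
`∑_k Ψ(k h) z^k = ∑_ρ term(c_ρ, u_ρ)(z)`, by Suzuki Thm 1.1 (2) on each lattice point and Fubini
(`∑_{ρ,k} ‖c_ρ (cosh(κ_ρ k h) - 1) z^k‖ ≤ ∑_ρ (2m(ρ)/γ²) · ∑_k (e^{h/2}‖z‖)^k < ∞`). -/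
theorem latticeGF_eq_borel {h : ℝ} (hh : 0 < h) {z : ℂ} (hz : ‖z‖ < Real.exp (-(h / 2))) :
    latticeGF h z = ∑' ρ : ZetaZeros.riemannZetaNontrivialZeros, term (coeff ρ) (mult h ρ) z := by
  have hz1 : ‖z‖ < 1 := hz.trans_le (by rw [Real.exp_le_one_iff]; linarith)
  set q : ℝ := Real.exp (h / 2) * ‖z‖ with hq
  have hq0 : 0 ≤ q := by positivity
  have hq1 : q < 1 := by
    calc q < Real.exp (h / 2) * Real.exp (-(h / 2)) := by rw [hq]; gcongr
      _ = 1 := by rw [← Real.exp_add]; simp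
  -- the double family
  set f : ZetaZeros.riemannZetaNontrivialZeros → ℕ → ℂ := fun ρ k ↦
    (riemannZetaZeroOrder (ρ : ℂ) : ℂ) *
      ((Complex.cosh (((ρ : ℂ) - 1 / 2) * (((k : ℝ) * h : ℝ) : ℂ)) - 1) / ((ρ : ℂ) - 1 / 2) ^ 2) *
        z ^ k with hf
  -- rows in `ρ` (Suzuki Thm 1.1 (2) at the lattice point `k h`)
  have hrow : ∀ k : ℕ, HasSum (fun ρ ↦ f ρ k) ((zetaScrew (k * h) : ℂ) * z ^ k) := fun k ↦
    (Suzuki2023_thm11_series_holds ((k : ℝ) * h)).mul_right (z ^ k)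
  -- columns in `k` (three geometric series)
  have hcol : ∀ ρ : ZetaZeros.riemannZetaNontrivialZeros,
      HasSum (fun k ↦ f ρ k) (term (coeff ρ) (mult h ρ) z) := by
    intro ρ
    have h0 := re_pos ρ.2
    have h1 := re_lt_one ρ.2
    refine hasSum_row h ρ ?_ ?_ hz1
    · rw [norm_mul, norm_mult]
      calc Real.exp (((ρ : ℂ).re - 1 / 2) * h) * ‖z‖
          < Real.exp (h / 2) * Real.exp (-(h / 2)) := by
            refine mul_lt_mul' (Real.exp_le_exp.2 (by nlinarith)) hz (norm_nonneg _) (Real.exp_pos _)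
        _ = 1 := by rw [← Real.exp_add]; simp
    · rw [norm_div, norm_mult, div_eq_mul_inv, ← Real.exp_neg]
      calc ‖z‖ * Real.exp (-(((ρ : ℂ).re - 1 / 2) * h))
          < Real.exp (-(h / 2)) * Real.exp (h / 2) := by
            refine mul_lt_mul'' hz (Real.exp_lt_exp.2 (by nlinarith)) (norm_nonneg _) (Real.exp_pos _).le
        _ = 1 := by rw [← Real.exp_add]; simp
  -- absolute convergence of the double family
  have hbound : ∀ (ρ : ZetaZeros.riemannZetaNontrivialZeros) (k : ℕ),
      ‖f ρ k‖ ≤ (2 * (riemannZetaZeroOrder (ρ : ℂ) : ℝ) / (ρ : ℂ).im ^ 2) * q ^ k := by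
    intro ρ k
    have hkh : 0 ≤ (k : ℝ) * h := by positivity
    have ht := ScrewLatticeFoz.norm_term_le ρ hkh
    have hσ : |(ρ : ℂ).re - 1 / 2| ≤ 1 / 2 := by
      have h0 := re_pos ρ.2
      have h1 := re_lt_one ρ.2
      rw [abs_le]; constructor <;> linarith
    have hexp : Real.exp (|(ρ : ℂ).re - 1 / 2| * ((k : ℝ) * h)) ≤ Real.exp (h / 2) ^ k := by
      rw [← Real.exp_nat_mul]
      refine Real.exp_le_exp.2 ?_
      have : |(ρ : ℂ).re - 1 / 2| * ((k : ℝ) * h) ≤ (1 / 2) * ((k : ℝ) * h) :=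
        mul_le_mul_of_nonneg_right hσ hkh
      linarith
    have hb0 : 0 ≤ 2 * (riemannZetaZeroOrder (ρ : ℂ) : ℝ) / (ρ : ℂ).im ^ 2 := by
      have hm := FordL33.order_pos ρ
      positivity
    rw [hf, norm_mul, norm_pow]
    calc ‖(riemannZetaZeroOrder (ρ : ℂ) : ℂ) *
          ((Complex.cosh (((ρ : ℂ) - 1 / 2) * (((k : ℝ) * h : ℝ) : ℂ)) - 1) / ((ρ : ℂ) - 1 / 2) ^ 2)‖ *
          ‖z‖ ^ k
        ≤ (Real.exp (|(ρ : ℂ).re - 1 / 2| * ((k : ℝ) * h)) *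
            (2 * (riemannZetaZeroOrder (ρ : ℂ) : ℝ) / (ρ : ℂ).im ^ 2)) * ‖z‖ ^ k := by gcongr
      _ ≤ (Real.exp (h / 2) ^ k * (2 * (riemannZetaZeroOrder (ρ : ℂ) : ℝ) / (ρ : ℂ).im ^ 2)) *
            ‖z‖ ^ k := by gcongr
      _ = (2 * (riemannZetaZeroOrder (ρ : ℂ) : ℝ) / (ρ : ℂ).im ^ 2) * q ^ k := by
          rw [hq, mul_pow]; ring
  have hg : Summable fun x : ZetaZeros.riemannZetaNontrivialZeros × ℕ ↦
      (2 * (riemannZetaZeroOrder (x.1 : ℂ) : ℝ) / (x.1 : ℂ).im ^ 2) * q ^ x.2 := by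
    refine Summable.mul_of_nonneg ZetaScrewGrowth.summable_two_mul_order_div_im_sq
      (summable_geometric_of_lt_one hq0 hq1) (fun ρ ↦ ?_) (fun k ↦ ?_)
    · have hm := FordL33.order_pos ρ
      positivity
    · positivity
  have hsum : Summable (Function.uncurry f) :=
    Summable.of_norm_bounded hg (fun x ↦ hbound x.1 x.2)
  -- Fubini
  calc latticeGF h z = ∑' k : ℕ, (zetaScrew (k * h) : ℂ) * z ^ k := rfl
    _ = ∑' k : ℕ, ∑' ρ : ZetaZeros.riemannZetaNontrivialZeros, f ρ k :=
        tsum_congr fun k ↦ (hrow k).tsum_eq.symm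
    _ = ∑' ρ : ZetaZeros.riemannZetaNontrivialZeros, ∑' k : ℕ, f ρ k := hsum.tsum_comm
    _ = ∑' ρ : ZetaZeros.riemannZetaNontrivialZeros, term (coeff ρ) (mult h ρ) z :=
        tsum_congr fun ρ ↦ (hcol ρ).tsum_eq

/-! ## 4. Row X-9 and the dichotomy -/

/-- **`CEIL(h) ∧ CC(h) ⟹ RH`** (`h > 0`): if the lattice samples of `Ψ` grow sub-exponentially and the
closure of the aliased pole field is countable inside the disc, then every non-trivial zero is on the
critical line. -/
theorem rh_of_latticeCeiling_of_countableClosure {h : ℝ} (hh : 0 < h) (hceil : LatticeCeiling h)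
    (hcc : CountableClosure h) : RiemannHypothesis := by
  have hnorm : ∀ ρ : ZetaZeros.riemannZetaNontrivialZeros, ‖mult h ρ‖ = 1 :=
    norm_eq_one_of_countable_closure (c := coeff) (u := mult h) summable_norm_coeff re_coeff_neg
      (mult_ne_zero h) (differentiableOn_latticeGF hceil) (Real.exp_pos (-(h / 2)))
      (fun p hp ↦ exp_neg_half_le_norm_of_mem hh.le hp)
      (fun _ hz ↦ latticeGF_eq_borel hh (mem_ball_zero_iff.1 hz)) hcc
  have hline : ∀ ρ : ZetaZeros.riemannZetaNontrivialZeros, (ρ : ℂ).re = 1 / 2 := by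
    intro ρ
    have h1 := hnorm ρ
    rw [norm_mult, Real.exp_eq_one_iff] at h1
    rcases mul_eq_zero.1 h1 with h1 | h1
    · linarith
    · exact absurd h1 hh.ne'
  refine quasiRiemannHypothesis_one_half_iff_holds.1 fun s hζ hσ hσ1 ↦ ?_
  have hs : s ∈ ZetaZeros.riemannZetaNontrivialZeros := mem_of_re_pos hζ (by linarith)
  have := hline ⟨s, hs⟩
  simp only at this
  linarith

/-- Under RH every zero is on the line, so every multiplier is unimodular. -/
theorem norm_mult_eq_one_of_rh (hRH : RiemannHypothesis) (h : ℝ)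
    (ρ : ZetaZeros.riemannZetaNontrivialZeros) : ‖mult h ρ‖ = 1 := by
  have hq : QuasiRiemannHypothesis (1 / 2 + 0) := by
    rw [add_zero]; exact quasiRiemannHypothesis_one_half_iff_holds.2 hRH
  have h0 := ScrewGradedFloor.strip_of_quasiRH hq (ρ : ℂ) ρ.2
  have h1 : (ρ : ℂ).re - 1 / 2 = 0 := by
    have := abs_nonneg ((ρ : ℂ).re - 1 / 2)
    exact abs_eq_zero.1 (le_antisymm h0 this)
  rw [norm_mult, h1, zero_mul, Real.exp_zero]

/-- **RH ⟹ the aliased pole field is empty.** -/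
theorem aliasedPoleSet_eq_empty_of_rh (hRH : RiemannHypothesis) (h : ℝ) : aliasedPoleSet h = ∅ := by
  ext p
  simp only [mem_empty_iff_false, iff_false]
  rintro ⟨hp1, ρ, hp | hp⟩
  · have : p = mult h ρ := hp
    rw [this, norm_mult_eq_one_of_rh hRH] at hp1
    exact lt_irrefl _ hp1
  · have : p = (mult h ρ)⁻¹ := hp
    rw [this, norm_inv, norm_mult_eq_one_of_rh hRH, inv_one] at hp1
    exact lt_irrefl _ hp1

/-- **RH ⟹ CC(h).** -/
theorem countableClosure_of_rh (hRH : RiemannHypothesis) (h : ℝ) : CountableClosure h := by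
  unfold CountableClosure
  rw [aliasedPoleSet_eq_empty_of_rh hRH, closure_empty, empty_inter]
  exact countable_empty

/-- A bounded lattice sequence has the sub-exponential ceiling. -/
theorem latticeCeiling_of_bounded {h : ℝ} (hb : ∃ K : ℝ, ∀ k : ℕ, |zetaScrew (k * h)| ≤ K) :
    LatticeCeiling h := by
  intro ε hε
  obtain ⟨K, hK⟩ := hb
  have hK0 : 0 ≤ K := (abs_nonneg _).trans (hK 0)
  refine ⟨K, fun k ↦ (hK k).trans ?_⟩
  have : 1 ≤ Real.exp (ε * k) := Real.one_le_exp (by positivity)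
  nlinarith

/-- **RH ⟹ CEIL(h)** (`Ψ` is bounded under RH, `ZetaScrewGrowth.abs_zetaScrew_le_of_RH`). -/
theorem latticeCeiling_of_rh (hRH : RiemannHypothesis) (h : ℝ) : LatticeCeiling h :=
  latticeCeiling_of_bounded ⟨_, fun k ↦ ZetaScrewGrowth.abs_zetaScrew_le_of_RH hRH (k * h)⟩

/-- **ROW X-9 (the splitting)**, `h > 0` arbitrary: `CEIL(h) ∧ CC(h) ↔ RiemannHypothesis`. -/
theorem latticeCeiling_and_countableClosure_iff_rh {h : ℝ} (hh : 0 < h) :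
    (LatticeCeiling h ∧ CountableClosure h) ↔ RiemannHypothesis :=
  ⟨fun hab ↦ rh_of_latticeCeiling_of_countableClosure hh hab.1 hab.2,
    fun hRH ↦ ⟨latticeCeiling_of_rh hRH h, countableClosure_of_rh hRH h⟩⟩

/-- **THE DICHOTOMY (RH-free content)**, `h > 0`: if the lattice samples `Ψ(k h)` grow sub-exponentially,
then EITHER the Riemann hypothesis holds OR the aliased pole field `{e^{∓(ρ-1/2)h}} ∩ 𝔻` has UNCOUNTABLE
closure inside the unit disc (walls of poles). -/
theorem latticeCeiling_dichotomy {h : ℝ} (hh : 0 < h) (hceil : LatticeCeiling h) :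
    RiemannHypothesis ∨ ¬ CountableClosure h := by
  by_cases hcc : CountableClosure h
  · exact Or.inl (rh_of_latticeCeiling_of_countableClosure hh hceil hcc)
  · exact Or.inr hcc

end Summit.RiemannHypothesis.RiemannHypothesis.Theorems.Splittings.ScrewLatticeContinuation
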